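import Summits.KontsevichZagierPeriods.Zeta5Search.Certificates.EisensteinHeights
import HarnessLib

/-!
# ζ(5) search — certificates: solving the two-heights system for `W(b)` and `U(b)`
(cell `pub-zeta5`, certifier 2, generation 2)

HONEST FRAMING: systematic search; no irrationality claim unless certified.

OUR work (Summit side; generic layer of the DECAY side). `Certificates/EisensteinHeights.lean` proved, for
`b` in the box and every height `Y > 0`,
`Σ_{k∈ℤ} R_b(k+iY) = i·(4π³A₂(Y)W(b) − (4/3)π⁵A₄(Y)U(b))`, `A_j(Y) = Σ_m m^j e^{−2πmY}`. Here:

* `Ar j Y` — the Eisenstein sums as REAL numbers, `Aq j Y = Ar j Y` (`Aq_eq_Ar`), with the elementary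
  enclosures `q ≤ A_j(Y)`, `Σ_{m<K} m^j q^m ≤ A_j(Y) ≤ Σ_{m<K} m^j q^m + K^j·j!·q^K/(1−q)^{j+1}`
  (`q = e^{−2πY}`; `le_Ar`, `sum_le_Ar`, `Ar_le_sum_add`, `Ar_mem`);
* `comb_le_of_majorant` — any termwise majorant `‖R_b(k+iY)‖ ≤ g k`, `Σ_k g k = S`, gives
  `|4π³A₂(Y)·W(b) − (4/3)π⁵A₄(Y)·U(b)| ≤ S`;
* `abs_le_of_two_combinations` — linear algebra: two such inequalities at heights `Y₁, Y₂` with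
  non-zero determinant bound `|W(b)|` and `|U(b)|` explicitly (`coeffW_abs_le`, `coeffU_abs_le`).

The ray-specific work (majorants `g`, their sums, the determinant's sign and the choice `Y ≈ 3n` that makes the
bound sharp) is done per ray (`Certificates/RecordRayCoeffBound.lean`).
-/

noncomputable section

open Finset Complex Filter Topology
open scoped Real Nat

namespace Summit.KontsevichZagierPeriods.Zeta5Search.DualPF

open Summit.KontsevichZagierPeriods.Zeta5Search.DualSeries
open Summit.KontsevichZagierPeriods.Zeta5Search.WedgeDictionary

/-! ### The Eisenstein sums as real numbers, with an enclosure -/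

/-- `q(Y) = e^{−2πY}` as a real number. -/
def qr (Y : ℝ) : ℝ := Real.exp (-(2 * π * Y))

/-- `A_j(Y) = Σ_{m≥0} m^j q(Y)^m` as a real number. -/
def Ar (j : ℕ) (Y : ℝ) : ℝ := ∑' m : ℕ, (m : ℝ) ^ j * qr Y ^ m

/-- `0 < q(Y)`. -/
theorem qr_pos (Y : ℝ) : 0 < qr Y := Real.exp_pos _

/-- `q(Y) < 1` for `Y > 0`. -/
theorem qr_lt_one {Y : ℝ} (hY : 0 < Y) : qr Y < 1 := by
  unfold qr
  rw [Real.exp_lt_one_iff]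
  have := Real.pi_pos
  nlinarith

/-- `‖q(Y)‖ < 1` for `Y > 0`. -/
theorem norm_qr_lt_one {Y : ℝ} (hY : 0 < Y) : ‖qr Y‖ < 1 := by
  rw [Real.norm_of_nonneg (qr_pos Y).le]; exact qr_lt_one hY

/-- The defining series of `A_j(Y)` converges. -/
theorem hasSum_Ar (j : ℕ) {Y : ℝ} (hY : 0 < Y) :
    HasSum (fun m : ℕ => (m : ℝ) ^ j * qr Y ^ m) (Ar j Y) :=
  (summable_pow_mul_geometric_of_norm_lt_one j (norm_qr_lt_one hY)).hasSum

/-- The complex Eisenstein sum is the real one: `Aq j Y = Ar j Y`. -/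
theorem Aq_eq_Ar (j : ℕ) (Y : ℝ) : Aq j Y = ((Ar j Y : ℝ) : ℂ) := by
  unfold Aq Ar
  rw [qY_eq, Complex.ofReal_tsum]
  congr 1
  funext m
  unfold qr
  push_cast
  ring

/-- Lower bound: `q ≤ A_j(Y)` (the term `m = 1`). -/
theorem le_Ar (j : ℕ) {Y : ℝ} (hY : 0 < Y) : qr Y ≤ Ar j Y := by
  have h := le_hasSum (hasSum_Ar j hY) 1
    (fun m _ => mul_nonneg (by positivity) (pow_nonneg (qr_pos Y).le m))
  simpa using h

/-- `A_j(Y) ≥ 0`. -/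
theorem Ar_nonneg (j : ℕ) {Y : ℝ} (hY : 0 < Y) : 0 ≤ Ar j Y :=
  (hasSum_Ar j hY).nonneg fun m => by have := qr_pos Y; positivity

/-- The combinatorial inequality behind the tail bounds: `(m+K)^j ≤ K^j · j! · C(m+j, j)` (`K ≥ 1`). -/
theorem pow_add_le (m j : ℕ) {K : ℕ} (hK : 1 ≤ K) : (m + K) ^ j ≤ K ^ j * (j ! * (m + j).choose j) := by
  have h1 : (m + K) ^ j ≤ (K * (m + 1)) ^ j := Nat.pow_le_pow_left (by nlinarith) j
  have h2 : (m + 1) ^ j ≤ (m + 1).ascFactorial j := Nat.pow_succ_le_ascFactorial (m + 1) j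
  rw [Nat.ascFactorial_eq_factorial_mul_choose] at h2
  calc (m + K) ^ j ≤ (K * (m + 1)) ^ j := h1
    _ = K ^ j * (m + 1) ^ j := Nat.mul_pow K (m + 1) j
    _ ≤ K ^ j * (j ! * (m + j).choose j) := Nat.mul_le_mul_left _ h2

/-- Partial sums from below: `Σ_{m<K} m^j q^m ≤ A_j(Y)`. -/
theorem sum_le_Ar (j K : ℕ) {Y : ℝ} (hY : 0 < Y) :
    ∑ m ∈ range K, (m : ℝ) ^ j * qr Y ^ m ≤ Ar j Y :=
  sum_le_hasSum (range K) (fun m _ => mul_nonneg (by positivity) (pow_nonneg (qr_pos Y).le m)) (hasSum_Ar j hY)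

/-- **Tail bound**: `A_j(Y) ≤ Σ_{m<K} m^j q^m + K^j·j!·q^K/(1−q)^{j+1}` (`K ≥ 1`; the terms `m ≥ K` against the
binomial series `Σ_m C(m+j,j) q^m = (1−q)^{−(j+1)}`). -/
theorem Ar_le_sum_add (j : ℕ) {K : ℕ} (hK : 1 ≤ K) {Y : ℝ} (hY : 0 < Y) :
    Ar j Y ≤ ∑ m ∈ range K, (m : ℝ) ^ j * qr Y ^ m + (K : ℝ) ^ j * j ! * qr Y ^ K / (1 - qr Y) ^ (j + 1) := by
  set q := qr Y with hq
  have hq0 : 0 < q := qr_pos Y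
  have hq1 : q < 1 := qr_lt_one hY
  have htail : HasSum (fun m : ℕ => ((m + K : ℕ) : ℝ) ^ j * q ^ (m + K))
      (Ar j Y - ∑ m ∈ range K, (m : ℝ) ^ j * q ^ m) := by
    have h := (hasSum_nat_add_iff' K).mpr (hasSum_Ar j hY)
    refine h.congr_fun fun m => ?_
    push_cast; rfl
  have hbin : HasSum (fun m : ℕ => ((K : ℝ) ^ j * j ! * q ^ K) * (((m + j).choose j : ℝ) * q ^ m))
      ((K : ℝ) ^ j * j ! * q ^ K * (1 / (1 - q) ^ (j + 1))) :=
    (hasSum_choose_mul_geometric_of_norm_lt_one j (norm_qr_lt_one hY)).mul_left _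
  have hle : ∀ m : ℕ, ((m + K : ℕ) : ℝ) ^ j * q ^ (m + K) ≤
      ((K : ℝ) ^ j * j ! * q ^ K) * (((m + j).choose j : ℝ) * q ^ m) := by
    intro m
    have hc : ((m + K : ℕ) : ℝ) ^ j ≤ (K : ℝ) ^ j * (j ! * ((m + j).choose j : ℝ)) := by
      exact_mod_cast pow_add_le m j hK
    have hqm : 0 ≤ q ^ m := by positivity
    calc ((m + K : ℕ) : ℝ) ^ j * q ^ (m + K) = ((m + K : ℕ) : ℝ) ^ j * (q ^ K * q ^ m) := by ring
      _ ≤ (K : ℝ) ^ j * (j ! * ((m + j).choose j : ℝ)) * (q ^ K * q ^ m) := by gcongr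
      _ = ((K : ℝ) ^ j * j ! * q ^ K) * (((m + j).choose j : ℝ) * q ^ m) := by ring
  have := hasSum_le hle htail hbin
  have e : (K : ℝ) ^ j * j ! * q ^ K * (1 / (1 - q) ^ (j + 1)) = (K : ℝ) ^ j * j ! * q ^ K / (1 - q) ^ (j + 1) := by
    ring
  linarith [this, e.le, e.ge]

/-- Enclosure used by the two-heights determinant: `q + 2^j q² ≤ A_j(Y) ≤ q + 2^j q² + 3^j·j!·q³/(1−q)^{j+1}`
(`j ≥ 1`). -/
theorem Ar_mem {j : ℕ} (hj : 1 ≤ j) {Y : ℝ} (hY : 0 < Y) :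
    qr Y + 2 ^ j * qr Y ^ 2 ≤ Ar j Y ∧
      Ar j Y ≤ qr Y + 2 ^ j * qr Y ^ 2 + 3 ^ j * j ! * qr Y ^ 3 / (1 - qr Y) ^ (j + 1) := by
  have h3 : ∑ m ∈ range 3, (m : ℝ) ^ j * qr Y ^ m = qr Y + 2 ^ j * qr Y ^ 2 := by
    simp [sum_range_succ, zero_pow (by omega : j ≠ 0)]
  constructor
  · have := sum_le_Ar j 3 hY; rwa [h3] at this
  · have := Ar_le_sum_add j (K := 3) (by norm_num) hY
    rw [h3] at this
    exact_mod_cast this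

/-! ### From the lattice-sum identity to a real inequality -/

section Comb

variable {b : ℕ → ℤ} (hb : InBox b) (hsum : ∑ j ∈ range 7, b (j + 1) ≤ 3 * b 0 + 1)
include hb hsum

/-- **One height**: any termwise majorant `‖R_b(k+iY)‖ ≤ g k` with `Σ_k g k = S` bounds the combination
`|4π³A₂(Y)·W(b) − (4/3)π⁵A₄(Y)·U(b)| ≤ S`. -/
theorem comb_le_of_majorant {Y : ℝ} (hY : 0 < Y) {g : ℤ → ℝ} {S : ℝ}
    (hg : HasSum g S) (hle : ∀ k : ℤ, ‖Rc b ((k : ℂ) + Y * I)‖ ≤ g k) :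
    |4 * π ^ 3 * Ar 2 Y * (coeffW b : ℝ) - 4 * π ^ 5 / 3 * Ar 4 Y * (coeffU b : ℝ)| ≤ S := by
  have h := (hasSum_Rc_line hb hsum hY).norm_le_of_bounded hg hle
  rw [Aq_eq_Ar, Aq_eq_Ar, norm_mul, norm_I, one_mul] at h
  have hcast : (4 * (π : ℂ) ^ 3 * ((Ar 2 Y : ℝ) : ℂ) * ((coeffW b : ℚ) : ℂ) -
      4 * (π : ℂ) ^ 5 / 3 * ((Ar 4 Y : ℝ) : ℂ) * ((coeffU b : ℚ) : ℂ)) =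
      ((4 * π ^ 3 * Ar 2 Y * (coeffW b : ℝ) - 4 * π ^ 5 / 3 * Ar 4 Y * (coeffU b : ℝ) : ℝ) : ℂ) := by
    push_cast; ring
  rwa [hcast, Complex.norm_real, Real.norm_eq_abs] at h

end Comb

/-! ### Linear algebra: two heights -/

/-- From `|a₁W − b₁U| ≤ S₁`, `|a₂W − b₂U| ≤ S₂` and `D = a₁b₂ − a₂b₁ ≠ 0`:
`|W| ≤ (|b₂|S₁ + |b₁|S₂)/|D|` and `|U| ≤ (|a₂|S₁ + |a₁|S₂)/|D|`. -/
theorem abs_le_of_two_combinations {a₁ b₁ a₂ b₂ W U S₁ S₂ : ℝ}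
    (h₁ : |a₁ * W - b₁ * U| ≤ S₁) (h₂ : |a₂ * W - b₂ * U| ≤ S₂) (hD : a₁ * b₂ - a₂ * b₁ ≠ 0) :
    |W| ≤ (|b₂| * S₁ + |b₁| * S₂) / |a₁ * b₂ - a₂ * b₁| ∧
      |U| ≤ (|a₂| * S₁ + |a₁| * S₂) / |a₁ * b₂ - a₂ * b₁| := by
  have hDpos : 0 < |a₁ * b₂ - a₂ * b₁| := abs_pos.2 hD
  constructor
  · rw [le_div_iff₀ hDpos, ← abs_mul]
    have e : W * (a₁ * b₂ - a₂ * b₁) = b₂ * (a₁ * W - b₁ * U) - b₁ * (a₂ * W - b₂ * U) := by ring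
    rw [e]
    calc |b₂ * (a₁ * W - b₁ * U) - b₁ * (a₂ * W - b₂ * U)|
        ≤ |b₂ * (a₁ * W - b₁ * U)| + |b₁ * (a₂ * W - b₂ * U)| := abs_sub _ _
      _ = |b₂| * |a₁ * W - b₁ * U| + |b₁| * |a₂ * W - b₂ * U| := by rw [abs_mul, abs_mul]
      _ ≤ |b₂| * S₁ + |b₁| * S₂ := by gcongr
  · rw [le_div_iff₀ hDpos, ← abs_mul]
    have e : U * (a₁ * b₂ - a₂ * b₁) = a₂ * (a₁ * W - b₁ * U) - a₁ * (a₂ * W - b₂ * U) := by ring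
    rw [e]
    calc |a₂ * (a₁ * W - b₁ * U) - a₁ * (a₂ * W - b₂ * U)|
        ≤ |a₂ * (a₁ * W - b₁ * U)| + |a₁ * (a₂ * W - b₂ * U)| := abs_sub _ _
      _ = |a₂| * |a₁ * W - b₁ * U| + |a₁| * |a₂ * W - b₂ * U| := by rw [abs_mul, abs_mul]
      _ ≤ |a₂| * S₁ + |a₁| * S₂ := by gcongr

section TwoHeights

variable {b : ℕ → ℤ} (hb : InBox b) (hsum : ∑ j ∈ range 7, b (j + 1) ≤ 3 * b 0 + 1)
include hb hsum

/-- The determinant of the two-heights system (up to the factor `(16/3)π⁸`):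
`Δ(Y₁,Y₂) = A₂(Y₁)A₄(Y₂) − A₂(Y₂)A₄(Y₁)`. -/
def detAr (Y₁ Y₂ : ℝ) : ℝ := Ar 2 Y₁ * Ar 4 Y₂ - Ar 2 Y₂ * Ar 4 Y₁

omit hb hsum in
/-- The system's determinant is `(16/3)π⁸·Δ`. -/
theorem det_eq (Y₁ Y₂ : ℝ) :
    (4 * π ^ 3 * Ar 2 Y₁) * (4 * π ^ 5 / 3 * Ar 4 Y₂) - (4 * π ^ 3 * Ar 2 Y₂) * (4 * π ^ 5 / 3 * Ar 4 Y₁)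
      = 16 * π ^ 8 / 3 * detAr Y₁ Y₂ := by
  unfold detAr; ring

/-- **TWO HEIGHTS**: termwise majorants on the lines `ℤ + iY₁`, `ℤ + iY₂` with sums `S₁`, `S₂` and a non-zero
determinant `Δ(Y₁,Y₂)` bound the `ζ(3)`-coefficient:
`|W(b)| ≤ (A₄(Y₂)S₁ + A₄(Y₁)S₂) / (4π³·|Δ|)`. -/
theorem coeffW_abs_le {Y₁ Y₂ : ℝ} (hY₁ : 0 < Y₁) (hY₂ : 0 < Y₂) {g₁ g₂ : ℤ → ℝ} {S₁ S₂ : ℝ}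
    (hg₁ : HasSum g₁ S₁) (hle₁ : ∀ k : ℤ, ‖Rc b ((k : ℂ) + Y₁ * I)‖ ≤ g₁ k)
    (hg₂ : HasSum g₂ S₂) (hle₂ : ∀ k : ℤ, ‖Rc b ((k : ℂ) + Y₂ * I)‖ ≤ g₂ k)
    (hD : detAr Y₁ Y₂ ≠ 0) :
    |(coeffW b : ℝ)| ≤ (Ar 4 Y₂ * S₁ + Ar 4 Y₁ * S₂) / (4 * π ^ 3 * |detAr Y₁ Y₂|) := by
  have h₁ := comb_le_of_majorant hb hsum hY₁ hg₁ hle₁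
  have h₂ := comb_le_of_majorant hb hsum hY₂ hg₂ hle₂
  have hD' : (4 * π ^ 3 * Ar 2 Y₁) * (4 * π ^ 5 / 3 * Ar 4 Y₂) -
      (4 * π ^ 3 * Ar 2 Y₂) * (4 * π ^ 5 / 3 * Ar 4 Y₁) ≠ 0 := by
    rw [det_eq]; have := Real.pi_pos; positivity
  have h := (abs_le_of_two_combinations h₁ h₂ hD').1
  rw [det_eq] at h
  have h4 : 0 ≤ Ar 4 Y₁ := Ar_nonneg 4 hY₁
  have h4' : 0 ≤ Ar 4 Y₂ := Ar_nonneg 4 hY₂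
  have hpi := Real.pi_pos
  rw [abs_of_nonneg (by positivity : (0 : ℝ) ≤ 4 * π ^ 5 / 3 * Ar 4 Y₂),
    abs_of_nonneg (by positivity : (0 : ℝ) ≤ 4 * π ^ 5 / 3 * Ar 4 Y₁), abs_mul,
    abs_of_nonneg (by positivity : (0 : ℝ) ≤ 16 * π ^ 8 / 3)] at h
  have hDpos : 0 < |detAr Y₁ Y₂| := abs_pos.2 hD
  calc |(coeffW b : ℝ)| ≤ (4 * π ^ 5 / 3 * Ar 4 Y₂ * S₁ + 4 * π ^ 5 / 3 * Ar 4 Y₁ * S₂) /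
        (16 * π ^ 8 / 3 * |detAr Y₁ Y₂|) := h
    _ = (Ar 4 Y₂ * S₁ + Ar 4 Y₁ * S₂) / (4 * π ^ 3 * |detAr Y₁ Y₂|) := by
        field_simp
        ring

/-- **TWO HEIGHTS**, the `ζ(5)`-coefficient: `|U(b)| ≤ 3(A₂(Y₂)S₁ + A₂(Y₁)S₂) / (4π⁵·|Δ|)`. -/
theorem coeffU_abs_le {Y₁ Y₂ : ℝ} (hY₁ : 0 < Y₁) (hY₂ : 0 < Y₂) {g₁ g₂ : ℤ → ℝ} {S₁ S₂ : ℝ}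
    (hg₁ : HasSum g₁ S₁) (hle₁ : ∀ k : ℤ, ‖Rc b ((k : ℂ) + Y₁ * I)‖ ≤ g₁ k)
    (hg₂ : HasSum g₂ S₂) (hle₂ : ∀ k : ℤ, ‖Rc b ((k : ℂ) + Y₂ * I)‖ ≤ g₂ k)
    (hD : detAr Y₁ Y₂ ≠ 0) :
    |(coeffU b : ℝ)| ≤ 3 * (Ar 2 Y₂ * S₁ + Ar 2 Y₁ * S₂) / (4 * π ^ 5 * |detAr Y₁ Y₂|) := by
  have h₁ := comb_le_of_majorant hb hsum hY₁ hg₁ hle₁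
  have h₂ := comb_le_of_majorant hb hsum hY₂ hg₂ hle₂
  have hD' : (4 * π ^ 3 * Ar 2 Y₁) * (4 * π ^ 5 / 3 * Ar 4 Y₂) -
      (4 * π ^ 3 * Ar 2 Y₂) * (4 * π ^ 5 / 3 * Ar 4 Y₁) ≠ 0 := by
    rw [det_eq]; have := Real.pi_pos; positivity
  have h := (abs_le_of_two_combinations h₁ h₂ hD').2
  rw [det_eq] at h
  have h2 : 0 ≤ Ar 2 Y₁ := Ar_nonneg 2 hY₁
  have h2' : 0 ≤ Ar 2 Y₂ := Ar_nonneg 2 hY₂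
  have hpi := Real.pi_pos
  rw [abs_of_nonneg (by positivity : (0 : ℝ) ≤ 4 * π ^ 3 * Ar 2 Y₂),
    abs_of_nonneg (by positivity : (0 : ℝ) ≤ 4 * π ^ 3 * Ar 2 Y₁), abs_mul,
    abs_of_nonneg (by positivity : (0 : ℝ) ≤ 16 * π ^ 8 / 3)] at h
  have hDpos : 0 < |detAr Y₁ Y₂| := abs_pos.2 hD
  calc |(coeffU b : ℝ)| ≤ (4 * π ^ 3 * Ar 2 Y₂ * S₁ + 4 * π ^ 3 * Ar 2 Y₁ * S₂) /
        (16 * π ^ 8 / 3 * |detAr Y₁ Y₂|) := h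
    _ = 3 * (Ar 2 Y₂ * S₁ + Ar 2 Y₁ * S₂) / (4 * π ^ 5 * |detAr Y₁ Y₂|) := by
        field_simp
        ring

end TwoHeights

end Summit.KontsevichZagierPeriods.Zeta5Search.DualPF
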